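import Summits.FinalStateConjecture.FinalStateConjecture.Theorems.StarvedNecksNecksCertifyStubHuygensNeck
import Summits.FinalStateConjecture.FinalStateConjecture.Theorems.StarvedNecksNecksCertifyStubKirchhoffFormula
import Summits.FinalStateConjecture.FinalStateConjecture.Theorems.StarvedNecksNecksCertifyStubSphericalMeansCalculus
import Summits.FinalStateConjecture.FinalStateConjecture.Theorems.StarvedNecksNecksCertifyStubSphereMeanDarboux

/-!
# Route StarvedNecks — crux `NecksCertify`, line `two-cap-focusing-ledger`: unconditional model rungs

Lead prover-line-stmt-FinalStateConjecture-13549-0 (2026-08-16).  The line's model rungs were registered and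
landed in CONDITIONAL form (`stub_sphericalMeansCalculus : Darboux → …`, `stub_kirchhoffFormula : SMC → …`,
`stub_huygensNeck : Kirchhoff → …`); this file composes them into the two unconditional classical
statements every wave-equation route of the summit can import:

* `kirchhoffFormula` — **Kirchhoff–Duhamel representation on `ℝ¹⁺³`** (Evans, PDE, §2.4.1(c), §2.4.2);
* `huygensNeckLemma` — **the Huygens neck lemma** (sharp Huygens at radius `ρ`: a starved cone ledger
  per unit wall radius forces `C²` decay on sublinear necks outside a black-box cylinder).

Anchor (registered helper sub-goal of `stub_neckLedgerAnalysis` on the crux item):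
`stub_neckLedgerAnalysis_kirchhoffExport` (= `kirchhoffFormula`).  No definitions, no named facts.
-/

noncomputable section

open scoped Manifold ContDiff Topology ENNReal
open Filter Set MeasureTheory Topology Literature.Geometry.Lorentzian

namespace Summit.FinalStateConjecture.FinalStateConjecture.Theorems.NecksCertifyTwoCap.Exports

set_option linter.dupNamespace false

/-- **Kirchhoff–Duhamel representation on `ℝ¹⁺³`, unconditional** (classical; Evans, PDE, §2.4.1(c),
§2.4.2): for every smooth `ψ : E4 → ℝ`, point `(t, x)` and radius `σ > 0`,
`ψ(t,x) = ⨍ψ(t−σ, x+σw) + σ⨍(∂ₜ + w·∇)ψ(t−σ, x+σw) − ∫₀^σ s⨍(□_ηψ)(t−s, x+sw) ds` (sphere averages w.r.t.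
`volume.toSphere`, `□_η = KerrSchild.waveOperator (fun _ ↦ Kerr.etaComp)`).  Composition of the landed
chain Darboux → spherical-means calculus → Kirchhoff. -/
theorem kirchhoffFormula :
  ∀ (ψ : E4 → ℝ), ContDiff ℝ ∞ ψ → ∀ (t : ℝ) (x : E3) (σ : ℝ), 0 < σ →
      ψ (E4.ofTimeSpace t x) =
        (((volume : Measure E3).toSphere univ).toReal)⁻¹ *
            ∫ (w : Metric.sphere (0 : E3) 1), ψ (E4.ofTimeSpace (t - σ) (x + σ • (w : E3)))
              ∂((volume : Measure E3).toSphere)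
        + σ * ((((volume : Measure E3).toSphere univ).toReal)⁻¹ *
            ∫ (w : Metric.sphere (0 : E3) 1),
              fderiv ℝ ψ (E4.ofTimeSpace (t - σ) (x + σ • (w : E3))) (E4.ofTimeSpace 1 (w : E3))
              ∂((volume : Measure E3).toSphere))
        - ∫ s in (0 : ℝ)..σ, s * ((((volume : Measure E3).toSphere univ).toReal)⁻¹ *
            ∫ (w : Metric.sphere (0 : E3) 1),
              KerrSchild.waveOperator (fun _ ↦ Kerr.etaComp) ψ (E4.ofTimeSpace (t - s) (x + s • (w : E3)))
              ∂((volume : Measure E3).toSphere)) :=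
  Kirchhoff.stub_kirchhoffFormula
    (SphericalMeans.stub_sphericalMeansCalculus Darboux.stub_sphereMeanDarboux)

/-- Registered anchor sub-goal of this file on the crux item (`stub_neckLedgerAnalysis_kirchhoffExport`):
Kirchhoff's formula, unconditional (same statement as `kirchhoffFormula`). -/
theorem stub_neckLedgerAnalysis_kirchhoffExport :
  ∀ (ψ : E4 → ℝ), ContDiff ℝ ∞ ψ → ∀ (t : ℝ) (x : E3) (σ : ℝ), 0 < σ →
      ψ (E4.ofTimeSpace t x) =
        (((volume : Measure E3).toSphere univ).toReal)⁻¹ *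
            ∫ (w : Metric.sphere (0 : E3) 1), ψ (E4.ofTimeSpace (t - σ) (x + σ • (w : E3)))
              ∂((volume : Measure E3).toSphere)
        + σ * ((((volume : Measure E3).toSphere univ).toReal)⁻¹ *
            ∫ (w : Metric.sphere (0 : E3) 1),
              fderiv ℝ ψ (E4.ofTimeSpace (t - σ) (x + σ • (w : E3))) (E4.ofTimeSpace 1 (w : E3))
              ∂((volume : Measure E3).toSphere))
        - ∫ s in (0 : ℝ)..σ, s * ((((volume : Measure E3).toSphere univ).toReal)⁻¹ *
            ∫ (w : Metric.sphere (0 : E3) 1),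
              KerrSchild.waveOperator (fun _ ↦ Kerr.etaComp) ψ (E4.ofTimeSpace (t - s) (x + s • (w : E3)))
              ∂((volume : Measure E3).toSphere)) :=
  kirchhoffFormula

/-- **The Huygens neck lemma, unconditional** (the line's lever in linear form): for a smooth `φ` with
`□_ηφ = 0` on the late exterior of a cylinder, a monotone sublinear wall `ρ ≥ R₀ + 2`, a vanishing `C³`
cylinder certificate, a vanishing `C²` flat certificate beyond `ρ` and a starved cone ledger (orders 1–3
per unit `ρ`), the `C²` sup on the necks `{y⁰ = s, R₀ + 1 ≤ |ȳ| ≤ ρ(s)}` tends to `0`.  M2 ∘ Kirchhoff. -/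
theorem huygensNeckLemma :
  ∀ (φ : E4 → ℝ) (T R₀ : ℝ) (ρ : ℝ → ℝ), 0 < R₀ → ContDiff ℝ ∞ φ →
      (∀ y : E4, T ≤ y 0 → R₀ ≤ E4.spatialNorm y →
        KerrSchild.waveOperator (fun _ ↦ Kerr.etaComp) φ y = 0) →
      Monotone ρ → (∀ s, R₀ + 2 ≤ ρ s) → Tendsto (fun s ↦ ρ s / s) atTop (𝓝 0) →
      Tendsto (fun s ↦ supCkENorm {y : E4 | y 0 = s ∧ R₀ ≤ E4.spatialNorm y ∧ E4.spatialNorm y ≤ R₀ + 1} 3 φ)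
        atTop (𝓝 0) →
      Tendsto (fun s ↦ supCkENorm {y : E4 | y 0 = s ∧ ρ s ≤ E4.spatialNorm y} 2 φ) atTop (𝓝 0) →
      (∀ e : ℝ, 0 < e → ∃ S : ℝ, ∀ (t : ℝ) (x : E3), S ≤ t → R₀ + 1 ≤ ‖x‖ → ‖x‖ ≤ ρ t →
        ∫ z in {z : E3 | 4 * ρ t ≤ ‖z - x‖ ∧ ‖z - x‖ ≤ 5 * ρ t},
            (∑ m ∈ Finset.Icc 1 3, ‖iteratedFDeriv ℝ m φ (E4.ofTimeSpace (t - ‖z - x‖) z)‖ ^ 2)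
          ≤ e * ρ t) →
      Tendsto (fun s ↦ supCkENorm
        {y : E4 | y 0 = s ∧ R₀ + 1 ≤ E4.spatialNorm y ∧ E4.spatialNorm y ≤ ρ s} 2 φ) atTop (𝓝 0) :=
  Huygens.stub_huygensNeck kirchhoffFormula

end Summit.FinalStateConjecture.FinalStateConjecture.Theorems.NecksCertifyTwoCap.Exports

end
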